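import Summits.QuantumFields.YangMills.Theorems.TransportPerturbationSynchronousShadowLawTransfer
import Literature.MathematicalPhysics.QuantumFieldTheory.Balaban1983to89.T3OrbitAverage
import HarnessLib

/-!
# Route `TransportPerturbation`, LINE 16 «synchronous_shadow» (crux K2 `WeightedAlmostInvariance`, stmt-QuantumFields-26987;
# load-bearing item `RegularWindowShadow`, stmt-QuantumFields-27784): construction note C1 — the transport weight `wd_K` is
# JOINTLY MEASURABLE

Planner ym-idea-5 g11's STUB-PLAN-L-W-C.md, note C1 for the load-bearing stub `stub_synchronousCoupling` (and for K1's frame facts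
27872/27873): `measurable_wdisc : Measurable (fun p : Cfg F K × Cfg F K => wdisc F K p.1 p.2)` — «inf over the compact group `GaugeTransf`
of a continuous function = inf over a countable dense subset; land once, `--supports stmt-QuantumFields-27784`».

THE ARGUMENT (Carathéodory).  `wd_K(u,v) = Σ_{j ≤ K} L^{-(K-j)} · discG_j(u,v)` with
`discG_j(u,v) = ⨅_{h ∈ SU(2)^{sites_j}} fieldDistAt_j(Ū_j, (V̄_j)^h)` (`Ū_j = avgField K j u`).  For FIXED `(u,v)` the function
`h ↦ fieldDistAt_j(Ū_j, (V̄_j)^h)` is CONTINUOUS on the gauge group `Site → SU(2)` (a finite sup of matrix-entry differences of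
`h(x) V̄(b) h(y)⁻¹`; `T3OrbitAverage.continuous_gaugeAct_left`), and the gauge group is second countable (scoped instances of
`T3OrbitAverage`), so it carries a DENSE SEQUENCE `D : ℕ → (Site → SU(2))` and the infimum over the group equals the infimum along
`D` (`ciInf_eq_ciInf_comp_of_denseRange`).  For FIXED `h` the function `(u,v) ↦ fieldDistAt_j(Ū_j, (V̄_j)^h)` is MEASURABLE
(Bałaban's iterated block average is measurable — `T4Continuum.measurable_iter` with `T3Family.avgMeasurable_of_measurableE` at
`T4ApexTwoLevel.measurableE_expMeanLogSU` — and `fieldDistAt_j`, `U ↦ U^h` are continuous on the Borel configuration spaces).  A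
countable infimum of measurable real functions is measurable (`Measurable.iInf`), and so is the finite weighted sum.

Also recorded: `measurable_toField`, `measurable_avgField`, `measurable_descendCfg`, the composition form `measurable_wdisc_comp`
and `measurable_couplingIntegrand` — the measurability conjunct of `SynchronousCoupling` holds AUTOMATICALLY for any pair of jointly
measurable solution families, so a prover of stub C only owes the mean estimate.

Cell `ym-idea-1` extra width seat `ym-line-sfw-p2-w5` gen 9 (free hands).  HONEST FRAMING: measure-theoretic plumbing; stub C itself
(`stub_synchronousCoupling`, XL) and `stub_fineWindowIdentity` are NOT proved; no crux, item, rung or summit is proved; the Yang–Mills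
mass gap is NOT proved by any of this (R3 is a RECORD rung).
-/

set_option autoImplicit false

noncomputable section

namespace Summit.QuantumFields.YangMills.Cruxes.WeightedAlmostInvariance.SynchronousShadow

open scoped BigOperators Topology Classical MeasureTheory NNReal ENNReal
open Filter Set Function MeasureTheory
open Literature.MathematicalPhysics.QuantumFieldTheory
open Literature.MathematicalPhysics.QuantumFieldTheory.Balaban1983to89
open Literature.MathematicalPhysics.QuantumLattice
open scoped Literature.MathematicalPhysics.QuantumFieldTheory.Balaban1983to89.T3OrbitAverage

/-! ## §1 A real-analysis lemma: the infimum of a continuous function along a dense sequence -/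

/-- **Infimum along a dense sequence.**  For a continuous real function `f` bounded below on a topological space with a dense
sequence `u`, `⨅ x, f x = ⨅ n, f (u n)`: `≤` termwise; `≥` because `{y | f y < ⨅ n, f (u n)}` is open, hence empty (it would contain
some `u n`). [folklore] -/
theorem ciInf_eq_ciInf_comp_of_denseRange {X : Type*} [TopologicalSpace X] {f : X → ℝ} (hf : Continuous f)
    (hbdd : BddBelow (Set.range f)) {u : ℕ → X} (hu : DenseRange u) : ⨅ x, f x = ⨅ n, f (u n) := by
  haveI : Nonempty X := ⟨u 0⟩
  have hbdd' : BddBelow (Set.range fun n => f (u n)) :=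
    hbdd.mono (by rintro _ ⟨n, rfl⟩; exact ⟨u n, rfl⟩)
  refine le_antisymm (le_ciInf fun n => ciInf_le hbdd (u n)) (le_ciInf fun x => ?_)
  by_contra hlt
  have hlt' : f x < ⨅ n, f (u n) := not_le.mp hlt
  obtain ⟨n, hn⟩ := hu.exists_mem_open (isOpen_lt hf continuous_const) ⟨x, hlt'⟩
  exact lt_irrefl _ (lt_of_lt_of_le hn (ciInf_le hbdd' n))

/-! ## §2 Measurability of the configuration maps of the skeleton -/

variable (F : T3ContinuumYM3Torus.T3Family)

/-- Reading a step-`K` link configuration as a level-0 gauge field is measurable (coordinate projections). [folklore] -/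
theorem measurable_toField (K : ℕ) : Measurable (toField F K) :=
  measurable_pi_lambda _ (fun b => measurable_pi_apply (b.src, b.dir))

/-- The `j`-fold block-averaged field `avgField K j` is a measurable function of the configuration (Bałaban's iterated average
(0.4) with the printed `exp[mean log]` small-loop average is measurable: `T4Continuum.measurable_iter` +
`T3Family.avgMeasurable_of_measurableE` + `T4ApexTwoLevel.measurableE_expMeanLogSU`). [cite: Balaban1987RG1, (0.4) p.253] -/
theorem measurable_avgField (K j : ℕ) : Measurable (avgField F K j) :=
  (T4Continuum.measurable_iter (fun i => BlockAveraging.blockAvg (P := F.P K) (j := i) avSU)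
      (fun i => F.avgMeasurable_of_measurableE avSU T4ApexTwoLevel.measurableE_expMeanLogSU K i) j).comp
    (measurable_toField F K)

/-- One renormalisation step on configurations, `descendCfg K : Cfg_{K+1} → Cfg_K`, is measurable
(`T3NestedUnitLaws.measurable_descend`). [cite: Balaban1987RG1, (0.4) p.253] -/
theorem measurable_descendCfg (K : ℕ) : Measurable (descendCfg F K) :=
  measurable_pi_lambda _ (fun e => (measurable_pi_apply (⟨e.1, e.2⟩ : PBond (F.P K) 0)).comp
    ((T3NestedUnitLaws.measurable_descend F avSU T4ApexTwoLevel.measurableE_expMeanLogSU K).comp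
      (measurable_toField F (K + 1))))

/-! ## §3 The sup-entry distance is continuous; the gauge-group infimum is a countable infimum -/

/-- A matrix entry of a bond variable is a continuous function of the configuration (product topology). [folklore] -/
theorem continuous_entry {K j : ℕ} (b : PBond (F.P K) j) (i k : Fin 2) :
    Continuous fun V : GaugeField (F.P K) j G2 => ((V b : G2) : Matrix (Fin 2) (Fin 2) ℂ) i k :=
  (continuous_subtype_val.comp
    (show Continuous (fun V : GaugeField (F.P K) j G2 => V b) from continuous_apply b)).matrix_elem i k

/-- The sup-entry distance `fieldDistAt K j` is jointly continuous (a finite supremum of norms of differences of continuous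
matrix entries). [folklore] -/
theorem continuous_fieldDistAt (K j : ℕ) :
    Continuous fun q : GaugeField (F.P K) j G2 × GaugeField (F.P K) j G2 => fieldDistAt F K j q.1 q.2 := by
  haveI : Nonempty (PBond (F.P K) j) := ⟨⟨default, ⟨0, (F.P K).hd⟩⟩⟩
  have hterm : ∀ p : PBond (F.P K) j × Fin 2 × Fin 2,
      Continuous fun q : GaugeField (F.P K) j G2 × GaugeField (F.P K) j G2 =>
        ‖((q.1 p.1 : G2) : Matrix (Fin 2) (Fin 2) ℂ) p.2.1 p.2.2 - ((q.2 p.1 : G2) : Matrix (Fin 2) (Fin 2) ℂ) p.2.1 p.2.2‖ :=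
    fun p => (((continuous_entry F p.1 p.2.1 p.2.2).comp continuous_fst).sub
      ((continuous_entry F p.1 p.2.1 p.2.2).comp continuous_snd)).norm
  have h := Continuous.finset_sup'_apply Finset.univ_nonempty (fun p _ => hterm p)
  simpa only [Finset.sup'_univ_eq_ciSup, fieldDistAt] using h

/-- The sup-entry distance is non-negative. [folklore] -/
theorem fieldDistAt_nonneg (K j : ℕ) (V V' : GaugeField (F.P K) j G2) : 0 ≤ fieldDistAt F K j V V' :=
  Real.iSup_nonneg fun _ => norm_nonneg _

/-- For fixed fields, `h ↦ fieldDistAt(V, (V')^h)` is continuous on the gauge group `SU(2)^{sites}`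
(`T3OrbitAverage.continuous_gaugeAct_left`). [cite: Balaban1985Averaging, (8) p.19] -/
theorem continuous_fieldDistAt_gaugeAct (K j : ℕ) (V V' : GaugeField (F.P K) j G2) :
    Continuous fun h : Site (F.P K) j → G2 => fieldDistAt F K j V (GaugeField.gaugeAct h V') :=
  (continuous_fieldDistAt F K j).comp (continuous_const.prodMk (T3OrbitAverage.continuous_gaugeAct_left V'))

/-- **The gauge-group infimum is a countable infimum**: along any dense sequence `D` of gauge transformations,
`discG K j u v = ⨅ n, fieldDistAt(Ū_j, (V̄_j)^{D n})`. [cite: Balaban1985Averaging, (8) p.19] -/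
theorem discG_eq_iInf_denseSeq (K j : ℕ) {D : ℕ → (Site (F.P K) j → G2)} (hD : DenseRange D) (u v : Cfg F K) :
    discG F K j u v = ⨅ n, fieldDistAt F K j (avgField F K j u) (GaugeField.gaugeAct (D n) (avgField F K j v)) :=
  ciInf_eq_ciInf_comp_of_denseRange (continuous_fieldDistAt_gaugeAct F K j _ _)
    ⟨0, by rintro _ ⟨h, rfl⟩; exact fieldDistAt_nonneg F K j _ _⟩ hD

/-! ## §4 Measurability of `discG`, `wd_K` and the coupling integrand -/

/-- **`discG K j` is jointly measurable** in the pair of configurations (countable infimum, along a dense sequence of the second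
countable gauge group, of functions measurable in the configurations). [cite: Balaban1985Averaging, (8) p.19] -/
theorem measurable_discG (K j : ℕ) : Measurable fun p : Cfg F K × Cfg F K => discG F K j p.1 p.2 := by
  obtain ⟨D, hD⟩ := TopologicalSpace.exists_dense_seq (Site (F.P K) j → G2)
  have hmeas : ∀ n, Measurable fun p : Cfg F K × Cfg F K =>
      fieldDistAt F K j (avgField F K j p.1) (GaugeField.gaugeAct (D n) (avgField F K j p.2)) := by
    intro n
    -- (built without expected-type propagation: unifying `Measurable (?g ∘ ?f)` against the goal first would unfold `fieldDistAt`)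
    have h1 : Measurable fun p : Cfg F K × Cfg F K =>
        (avgField F K j p.1, GaugeField.gaugeAct (D n) (avgField F K j p.2)) :=
      ((measurable_avgField F K j).comp measurable_fst).prodMk
        ((T3OrbitAverage.continuous_gaugeAct (D n)).measurable.comp ((measurable_avgField F K j).comp measurable_snd))
    have h2 := (continuous_fieldDistAt F K j).measurable.comp h1
    exact h2
  have heq : (fun p : Cfg F K × Cfg F K => discG F K j p.1 p.2) = fun p =>
      ⨅ n, fieldDistAt F K j (avgField F K j p.1) (GaugeField.gaugeAct (D n) (avgField F K j p.2)) :=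
    funext fun p => discG_eq_iInf_denseSeq F K j hD p.1 p.2
  rw [heq]
  exact Measurable.iInf hmeas

/-- **C1: the transport weight `wd_K` is jointly measurable** — `Measurable (fun p : Cfg F K × Cfg F K => wdisc F K p.1 p.2)`
(finite weighted sum of the measurable `discG K j`).  Construction note C1 of planner ym-idea-5 g11's STUB-PLAN for LINE 16; also the
frame fact wanted by K1's items 27872/27873. [cite: Balaban1985Averaging, (8) p.19] -/
theorem measurable_wdisc (K : ℕ) : Measurable fun p : Cfg F K × Cfg F K => wdisc F K p.1 p.2 := by
  unfold wdisc
  exact Finset.measurable_sum _ fun j _ => (measurable_discG F K j).const_mul _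

/-- `wd_K(X, Y)` is a measurable function of `ω` for measurable random configurations `X, Y`. [folklore] -/
theorem measurable_wdisc_comp (K : ℕ) {Ω : Type*} [MeasurableSpace Ω] {X Y : Ω → Cfg F K}
    (hX : Measurable X) (hY : Measurable Y) : Measurable fun ω => wdisc F K (X ω) (Y ω) := by
  -- `have`/`exact`: elaborating the composition against the goal would unfold `wdisc` (whnf blow-up)
  have h := (measurable_wdisc F K).comp (hX.prodMk hY)
  exact h

/-- **The measurability conjunct of `SynchronousCoupling` is automatic**: for any two jointly measurable solution families — a
step-`(K+1)` family `V'` and a step-`K` family `V` on one probability space — every fine start `U` and all lattice times `t', t`,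
the coupling integrand `ω ↦ wd_K(descend(V'(U)_{t'} ω), V(descend U)_t ω)` is measurable.  A prover of stub C therefore only owes the
mean estimate `E wd_K ≤ ρ_K²`. [cite: Balaban1985Averaging, (8) p.19] -/
theorem measurable_couplingIntegrand (γ : ℝ) (K : ℕ) {Ω : Type} [MeasurableSpace Ω] {P : Measure Ω}
    {W' : ℝ≥0 → Ω → (Edge 3 ((F.P (K + 1)).sitesPerDir 0) × NoiseIdx 2 → ℝ)} {hW' : IsFlatBrownian W' P}
    {V' : Cfg F (K + 1) → ℝ≥0 → Ω → Cfg F (K + 1)} (hV' : IsSolFamily F γ (K + 1) P W' hW' V')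
    {W : ℝ≥0 → Ω → (Edge 3 ((F.P K).sitesPerDir 0) × NoiseIdx 2 → ℝ)} {hW : IsFlatBrownian W P}
    {V : Cfg F K → ℝ≥0 → Ω → Cfg F K} (hV : IsSolFamily F γ K P W hW V)
    (U : GaugeField (F.P (K + 1)) 0 G2) (t' t : ℝ≥0) :
    Measurable fun ω => wdisc F K (descendCfg F K (V' (fun e => U ⟨e.1, e.2⟩) t' ω))
      (V (fun e => T3NestedUnitLaws.descend F
        (ExpMeanLog.expMeanLogSU : LoopAverage (Matrix.specialUnitaryGroup (Fin 2) ℂ)) K U ⟨e.1, e.2⟩) t ω) := by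
  have hX := (measurable_descendCfg F K).comp (measurable_section_of_isSolFamily F γ (K + 1) hV' (fun e => U ⟨e.1, e.2⟩) t')
  have hY := measurable_section_of_isSolFamily F γ K hV (fun e => T3NestedUnitLaws.descend F
    (ExpMeanLog.expMeanLogSU : LoopAverage (Matrix.specialUnitaryGroup (Fin 2) ℂ)) K U ⟨e.1, e.2⟩) t
  have h := measurable_wdisc_comp F K hX hY
  exact h

end Summit.QuantumFields.YangMills.Cruxes.WeightedAlmostInvariance.SynchronousShadow

end
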